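import Summits.CriticalPhenomena.CardyFormulaZ2.Theorems.CardyMagicRigidityNestingRigidityBigLoopsExpMomentMeetZ2
import HarnessLib

/-!
# Crux `NestingRigidity`, line `positive-cone-weight-doubling`: keystone K6 for the loops MEETING a
# window, site-`𝕋` half and both lattices

Crux `Summit.CriticalPhenomena.CardyFormulaZ2.Theses.CardyMagicRigidity.NestingRigidity`
(stmt-CriticalPhenomena-4835), line `positive-cone-weight-doubling`, registered helper Ξ₂
`uvFarBiteSq_expMoment_latticeEnsembles`.  Continuing …BigLoopsExpMomentMeetZ2 (bond-`ℤ²`): the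
all-order exponential moments, uniformly in the mesh, of the number of loops of diameter `≥ η` whose
trace MEETS `B̄(0, R)` — however far they extend (the loops crossing out of the window are the big
outer loops of the far part of the UV statistic).

* §1 the site-`𝕋` half (`expMoment_ncard_bigLoops_meeting_le_tEns`): the proof of
  `expMoment_ncard_bigLoops_le_tEns` (…BigLoopsExpMoment) verbatim — thin cover of `B̄(0, R)`,
  first-disc patterns, the joint disjoint occurrence of the confined arm events `triArm`
  (…BigLoopsExpMomentBKT), iterated BK, the Bollobás–Riordan annulus bound, colour flip, and the
  summation `BigLoopsExp.integral_exp_le_of_jointTails`; the window enters only through a point of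
  the trace in `B̄(0, R)` and the finiteness of the loops meeting `B̄(0, R)` at a fixed mesh;
* §2 both lattice ensembles (registered anchor `expMoment_ncard_bigLoops_meeting_le`), by cases on
  `latticeEnsembles = {zEns, tEns}`.
No cited fact, no definition.
-/

noncomputable section

open MeasureTheory Set Filter Metric
open scoped Real Topology BigOperators ENNReal

namespace Summit.CriticalPhenomena.CardyFormulaZ2.Cruxes.NestingRigidity.PositiveConeWeightDoubling

open Literature.Probability.RandomPlanarGeometry Literature.Probability.Percolation
  Literature.Probability.LatticeModels
open Summit.CriticalPhenomena.CardyFormulaZ2.Cruxes.NestingRigidity.RingCloudTomography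

/-! ## §1 The site-`𝕋` half -/

/-- **K6 for the loops MEETING a window, site-`𝕋`: all-order exponential moments, uniformly in the
mesh.**  For all `s R η` with `0 < η ≤ R` there are `C, c₀ > 0` such that for every mesh `0 < δ` with
`c₀ δ ≤ η`, the number `N` of loops of `tEns.X δ = siteLoopConfig δ` whose trace MEETS `B̄(0, R)` and has
diameter `≥ η` has `E[exp(s N)] ≤ C` (integrability included); `C = 2 · 2^{81 (R/r)²}`,
`r = (η/16)(e^{-2 max(s,0)}/2)^{1/α}`, `c₀ = 1000 η / r` (proof of `expMoment_ncard_bigLoops_le_tEns`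
verbatim). -/
theorem expMoment_ncard_bigLoops_meeting_le_tEns : ∀ (s R η : ℝ), 0 < η → η ≤ R → ∃ C c₀ : ℝ, 0 < C ∧ 0 < c₀ ∧ ∀ δ : ℝ, 0 < δ → c₀ * δ ≤ η → Integrable (fun ω ↦ Real.exp (s * ({u ∈ (tEns.X δ ω).loops | (u.range ∩ Metric.closedBall (0 : ℂ) R).Nonempty ∧ η ≤ Metric.diam u.range}.ncard : ℝ))) tEns.P ∧ ∫ ω, Real.exp (s * ({u ∈ (tEns.X δ ω).loops | (u.range ∩ Metric.closedBall (0 : ℂ) R).Nonempty ∧ η ≤ Metric.diam u.range}.ncard : ℝ)) ∂tEns.P ≤ C := by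
  classical
  intro s R η hη hηR
  haveI : IsProbabilityMeasure tEns.P := isProbabilityMeasure_of_mem tEns_mem
  haveI : IsProbabilityMeasure (triSitePercolation half) := isProbabilityMeasure_of_mem tEns_mem
  obtain ⟨α, hα, hb⟩ := tri_annulusCrossing_bound_holds
  -- the order `t ≥ 0`, the tail parameter `p`, the disc radius `r`
  set t : ℝ := max s 0 with ht_def
  have ht0 : 0 ≤ t := le_max_right _ _
  have hst : s ≤ t := le_max_left _ _
  set p : ℝ := Real.exp (-(2 * t)) / 2 with hp_def
  have hp0 : 0 < p := by positivity
  have hp1 : p ≤ 1 := by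
    have : Real.exp (-(2 * t)) ≤ 1 := Real.exp_le_one_iff.2 (by linarith)
    rw [hp_def]; linarith
  have hqp : Real.exp (2 * t) * p ≤ 1 / 2 := by
    rw [hp_def, ← mul_div_assoc, ← Real.exp_add, add_neg_cancel, Real.exp_zero]
  set r : ℝ := η / 16 * p ^ (1 / α) with hr_def
  have hpα : p ^ (1 / α) ≤ 1 := Real.rpow_le_one hp0.le hp1 (by positivity)
  have hr0 : 0 < r := by positivity
  have hrη : r ≤ η / 16 := by rw [hr_def]; exact mul_le_of_le_one_right (by positivity) hpα
  have hrR : r ≤ R := by linarith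
  have hkey : (16 * r / η) ^ α = p := by
    have h16 : 16 * r / η = p ^ (1 / α) := by rw [hr_def]; field_simp
    rw [h16, ← Real.rpow_mul hp0.le, one_div_mul_cancel hα.ne', Real.rpow_one]
  -- the cover of `B̄(0, R)` by `B ≤ 81 (R/r)²` discs of radius `r`
  obtain ⟨S, hScard, hcover⟩ := BigLoops.exists_cover_closedBall hr0 hrR
  set B : ℕ := S.card with hB
  set c : Fin B → ℂ := fun i ↦ (r : ℂ) * ((S.equivFin.symm i : S) : ℂ) with hc
  have hcov : ∀ z ∈ closedBall (0 : ℂ) R, ∃ i, z ∈ closedBall (c i) r := by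
    intro z hz
    obtain ⟨y, hy, hzy⟩ := mem_iUnion₂.1 (hcover hz)
    refine ⟨S.equivFin ⟨y, hy⟩, ?_⟩
    rw [hc]
    dsimp only
    rw [Equiv.symm_apply_apply]
    exact hzy
  have hBC : (2 : ℝ) * 2 ^ B ≤ 2 * (2 : ℝ) ^ (81 * (R / r) ^ 2) := by
    refine mul_le_mul_of_nonneg_left ?_ (by norm_num)
    rw [← Real.rpow_natCast]
    exact Real.rpow_le_rpow_of_exponent_le (by norm_num) hScard
  refine ⟨2 * (2 : ℝ) ^ (81 * (R / r) ^ 2), 1000 * η / r, by positivity, by positivity,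
    fun δ hδ hδη ↦ ?_⟩
  -- mesh conditions
  have hκδ : 1000 * δ ≤ r := by
    rw [div_mul_eq_mul_div, div_le_iff₀ hr0] at hδη
    exact le_of_mul_le_mul_right (by linarith) hη
  have hab : r + 5 * δ ≤ η / 4 := by linarith
  have hratio : (r + 3 * δ + δ) / (η / 4 - 2 * δ - δ) ≤ 16 * r / η := by
    rw [div_le_div_iff₀ (by linarith) hη]
    nlinarith [mul_le_mul_of_nonneg_right hκδ hη.le,
      mul_le_mul_of_nonneg_left hκδ (by positivity : (0 : ℝ) ≤ 2 * r),
      mul_le_mul_of_nonneg_left hrη (by positivity : (0 : ℝ) ≤ 2 * r), mul_pos hr0 hη]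
  have hpA : ∀ x : ℂ, (triSitePercolation half).real (triArm δ x (r + 3 * δ) (η / 4 - 2 * δ)) ≤ p := by
    intro x
    refine (real_triArm_le hb hδ x (by linarith) (by linarith)).trans ?_
    rw [← hkey]
    exact Real.rpow_le_rpow (div_nonneg (by linarith) (by linarith)) hratio hα.le
  -- the statistic: measurability, boundedness, integrability
  set big : UnbasedLoop ℂ → Prop := fun u ↦
    (u.range ∩ Metric.closedBall (0 : ℂ) R).Nonempty ∧ η ≤ Metric.diam u.range with hbig
  obtain ⟨Mb, hMb⟩ := BigLoopsMeet.exists_ncard_loops_sep_meeting_le tEns tEns_mem hδ R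
  have hmeasN : Measurable fun ω ↦ ({u ∈ (tEns.X δ ω).loops | big u}.ncard : ℝ) :=
    measurable_from_nat.comp (BigLoops.measurable_ncard_loops_sep tEns tEns_mem δ big)
  have hint : ∀ a : ℝ, Integrable
      (fun ω ↦ Real.exp (a * ({u ∈ (tEns.X δ ω).loops | big u}.ncard : ℝ))) tEns.P := by
    intro a
    refine Integrable.of_bound (Real.measurable_exp.comp (hmeasN.const_mul a)).aestronglyMeasurable
      (Real.exp (|a| * Mb)) (Eventually.of_forall fun ω ↦ ?_)
    rw [Real.norm_eq_abs, Real.abs_exp]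
    refine Real.exp_le_exp.2 ?_
    have h1 : ({u ∈ (tEns.X δ ω).loops | big u}.ncard : ℝ) ≤ Mb := by
      exact_mod_cast (hMb big (fun u h ↦ h.1) ω).2
    have h2 : (0 : ℝ) ≤ ({u ∈ (tEns.X δ ω).loops | big u}.ncard : ℝ) := Nat.cast_nonneg _
    calc a * ({u ∈ (tEns.X δ ω).loops | big u}.ncard : ℝ)
        ≤ |a| * ({u ∈ (tEns.X δ ω).loops | big u}.ncard : ℝ) :=
          mul_le_mul_of_nonneg_right (le_abs_self a) h2
      _ ≤ |a| * Mb := mul_le_mul_of_nonneg_left h1 (abs_nonneg a)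
  refine ⟨hint s, ?_⟩
  -- reduce to the order `t`
  have hmono : ∫ ω, Real.exp (s * ({u ∈ (tEns.X δ ω).loops | big u}.ncard : ℝ)) ∂tEns.P ≤
      ∫ ω, Real.exp (t * ({u ∈ (tEns.X δ ω).loops | big u}.ncard : ℝ)) ∂tEns.P :=
    integral_mono (hint s) (hint t) fun ω ↦
      Real.exp_le_exp.2 (mul_le_mul_of_nonneg_right hst (Nat.cast_nonneg _))
  refine hmono.trans (le_trans ?_ hBC)
  -- the pattern events
  set A : Fin B → Set (SiteConfig (Site 2)) := fun i ↦
    triArm δ (c i) (r + 3 * δ) (η / 4 - 2 * δ) with hA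
  set EV₁ : (Fin B → ℕ) → Set (SiteConfig (Site 2)) := fun f ↦
    (List.ofFn fun i ↦ disjointOccurrencePow (A i) (f i)).foldr disjointOccurrence univ with hEV₁
  set EV₀ : (Fin B → ℕ) → Set (SiteConfig (Site 2)) := fun f ↦ compl ⁻¹'
    (List.ofFn fun i ↦ disjointOccurrencePow (A i) (f i)).foldr disjointOccurrence univ with hEV₀
  -- a common determining finite set of sites
  have hdet : ∀ i, ∃ F : Finset (Site 2), DeterminedBy (A i) ↑F :=
    fun i ↦ exists_finset_determinedBy_triArm hδ (c i) _ _
  choose Fd hFd using hdet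
  set F : Finset (Site 2) := Finset.univ.biUnion Fd with hF
  have hAF : ∀ i, DeterminedBy (A i) ↑F := fun i ↦ (hFd i).mono fun e he ↦ by
    rw [hF, Finset.coe_biUnion]
    exact mem_iUnion₂.2 ⟨i, Finset.mem_coe.2 (Finset.mem_univ i), he⟩
  -- BK
  have hBK : ∀ (A₁ A₂ : Set (SiteConfig (Site 2))), IsUpperSet A₁ → IsUpperSet A₂ →
      DeterminedBy A₁ ↑F → DeterminedBy A₂ ↑F →
      (triSitePercolation half).real (A₁ □ A₂) ≤
        (triSitePercolation half).real A₁ * (triSitePercolation half).real A₂ := by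
    intro A₁ A₂ h₁ h₂ h₁F h₂F
    rw [triSitePercolation_eq]
    exact sitePercolation_bk half h₁F h₂F h₁ h₂
  -- joint geometric tails
  have htail : ∀ f : Fin B → ℕ, (triSitePercolation half).real ((List.ofFn fun i ↦
      disjointOccurrencePow (A i) (f i)).foldr disjointOccurrence univ) ≤ p ^ (∑ i, f i) := by
    intro f
    refine (BigLoopsExp.measureReal_foldr_ofFn_le_prod _ hBK A f (fun i ↦ isUpperSet_triArm δ _ _ _)
      hAF).trans ?_
    rw [← Finset.prod_pow_eq_pow_sum]
    exact Finset.prod_le_prod (fun i _ ↦ pow_nonneg measureReal_nonneg _) fun i _ ↦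
      pow_le_pow_left₀ measureReal_nonneg (hpA _) _
  have hP₁ : ∀ f, (triSitePercolation half).real (EV₁ f) ≤ p ^ (∑ i, f i) := htail
  have hP₀ : ∀ f, (triSitePercolation half).real (EV₀ f) ≤ p ^ (∑ i, f i) := fun f ↦
    (ENNReal.toReal_mono (measure_ne_top _ _) (BigLoopsExp.measure_preimage_compl_le _)).trans
      (htail f)
  have hm₁ : ∀ f, MeasurableSet (EV₁ f) := fun f ↦
    (BigLoopsExp.determinedBy_foldr (BigLoopsExp.determinedBy_of_mem_ofFn hAF f)).measurableSet_of_finset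
  have hm₀ : ∀ f, MeasurableSet (EV₀ f) := fun f ↦ measurable_compl (hm₁ f)
  -- summation
  change ∫ ω, Real.exp (t * ({u ∈ (siteLoopConfig δ ω).loops | big u}.ncard : ℝ))
    ∂(triSitePercolation half) ≤ 2 * 2 ^ B
  refine BigLoopsExp.integral_exp_le_of_jointTails (triSitePercolation half) ht0 hp0.le hqp
    EV₁ EV₀ hm₁ hm₀ hP₁ hP₀ (M := Mb)
    (N := fun ω ↦ {u ∈ (siteLoopConfig δ ω).loops | big u}.ncard) (hint t) (ae_of_all _ fun ω ↦ ?_)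
  -- the patterns
  set meets : Fin B → UnbasedLoop ℂ → Prop := fun i u ↦ (u.range ∩ closedBall (c i) r).Nonempty
    with hmeets
  set T : Fin 2 → Fin B → Set (UnbasedLoop ℂ) := fun τ i ↦
    {u ∈ (siteLoopConfig δ ω).F τ | big u ∧ (meets i u ∧ ∀ j < i, ¬ meets j u)} with hT
  have hBigfin : {u ∈ (siteLoopConfig δ ω).loops | big u}.Finite := (hMb big (fun u h ↦ h.1) ω).1
  have hTsub : ∀ τ i, T τ i ⊆ {u ∈ (siteLoopConfig δ ω).loops | big u} :=
    fun τ i u hu ↦ ⟨LoopConfig.subset_loops _ τ hu.1, hu.2.1⟩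
  have hTfin : ∀ τ i, (T τ i).Finite := fun τ i ↦ hBigfin.subset (hTsub τ i)
  have hTle : ∀ τ i, (T τ i).ncard ≤ Mb := fun τ i ↦
    (ncard_le_ncard (hTsub τ i) hBigfin).trans (hMb big (fun u h ↦ h.1) ω).2
  have hTdisj : ∀ τ, Pairwise fun i i' ↦ Disjoint (T τ i) (T τ i') := by
    intro τ i i' hii'
    rw [Set.disjoint_left]
    rintro u ⟨-, -, hfi⟩ ⟨-, -, hfi'⟩
    rcases lt_or_gt_of_ne hii' with h | h
    · exact hfi'.2 i h hfi.1
    · exact hfi.2 i' h hfi'.1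
  have hmeet : ∀ τ i, ∀ u ∈ T τ i, (u.range ∩ Metric.closedBall (c i) r).Nonempty ∧
      (u.range ∩ (Metric.ball (c i) (η / 4))ᶜ).Nonempty := by
    rintro τ i u ⟨-, ⟨-, hdiam⟩, hfi⟩
    refine ⟨hfi.1, ?_⟩
    by_contra hcon
    have hsub : u.range ⊆ ball (c i) (η / 4) := fun z hz ↦ by
      by_contra hz'
      exact hcon ⟨z, hz, hz'⟩
    have := (diam_mono hsub isBounded_ball).trans (diam_ball (by positivity : (0 : ℝ) ≤ η / 4))
    linarith
  refine ⟨fun i ↦ (T 1 i).ncard, fun i ↦ (T 0 i).ncard, hTle 1, hTle 0, ?_, ?_, ?_⟩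
  · exact BigLoopsExp.mem_foldr_triArm_of_typeOne_families hδ (a := fun _ ↦ r) (b := fun _ ↦ η / 4)
      (fun _ ↦ hab) c (T 1) (fun i u hu ↦ hu.1) (hTfin 1) (hTdisj 1) (hmeet 1) _ fun i ↦ le_rfl
  · exact BigLoopsExp.mem_foldr_triArm_compl_of_typeZero_families hδ (a := fun _ ↦ r)
      (b := fun _ ↦ η / 4) (fun _ ↦ hab) c (T 0) (fun i u hu ↦ hu.1) (hTfin 0) (hTdisj 0)
      (hmeet 0) _ fun i ↦ le_rfl
  · -- every big loop has a type and a first disc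
    have hsub : {u ∈ (siteLoopConfig δ ω).loops | big u} ⊆
        ⋃ i ∈ (Finset.univ : Finset (Fin B)), (T 1 i ∪ T 0 i) := by
      rintro u ⟨hu, hbu⟩
      obtain ⟨z, hz, hzR⟩ := hbu.1
      obtain ⟨i₀, hi₀⟩ := hcov z hzR
      obtain ⟨i, hi, hmin⟩ := BigLoopsExp.exists_first (fun i ↦ meets i u) ⟨i₀, z, hz, hi₀⟩
      refine mem_iUnion₂.2 ⟨i, Finset.mem_univ _, ?_⟩
      rcases LoopConfig.mem_loops_iff.1 hu with h0 | h1
      · exact Or.inr ⟨h0, hbu, hi, hmin⟩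
      · exact Or.inl ⟨h1, hbu, hi, hmin⟩
    have hUfin : (⋃ i ∈ (Finset.univ : Finset (Fin B)), (T 1 i ∪ T 0 i)).Finite :=
      hBigfin.subset (iUnion₂_subset fun i _ ↦ union_subset (hTsub 1 i) (hTsub 0 i))
    calc {u ∈ (siteLoopConfig δ ω).loops | big u}.ncard
        ≤ (⋃ i ∈ (Finset.univ : Finset (Fin B)), (T 1 i ∪ T 0 i)).ncard := ncard_le_ncard hsub hUfin
      _ ≤ ∑ i, (T 1 i ∪ T 0 i).ncard := Finset.set_ncard_biUnion_le _ _
      _ ≤ ∑ i, ((T 1 i).ncard + (T 0 i).ncard) := Finset.sum_le_sum fun i _ ↦ ncard_union_le _ _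
      _ = ∑ i, (T 1 i).ncard + ∑ i, (T 0 i).ncard := Finset.sum_add_distrib

/-! ## §2 Both lattice ensembles (the registered anchor) -/

/-- **K6 for the loops MEETING a window, both lattices: all-order exponential moments of the number
of loops of diameter `≥ η` whose trace meets `B̄(0, R)`, uniformly in the mesh** (registered helper
toward Ξ₂ `uvFarBiteSq_expMoment_latticeEnsembles`, line `positive-cone-weight-doubling`).  For
`E ∈ latticeEnsembles` and all `s R η` with `0 < η ≤ R` there are `C, c₀ > 0` such that for every mesh
`0 < δ` with `c₀ δ ≤ η`, `E_δ[exp(s · #{u ∈ X_δ : trace u ∩ B̄(0, R) ≠ ∅, diam (trace u) ≥ η})] ≤ C`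
(integrability included): the loops are NOT confined to the window — the big loops crossing the
annulus around it are counted (`expMoment_ncard_bigLoops_meeting_le_zEns`, `…_tEns`). -/
theorem expMoment_ncard_bigLoops_meeting_le : ∀ E ∈ latticeEnsembles, ∀ (s R η : ℝ), 0 < η → η ≤ R → ∃ C c₀ : ℝ, 0 < C ∧ 0 < c₀ ∧ ∀ δ : ℝ, 0 < δ → c₀ * δ ≤ η → Integrable (fun ω ↦ Real.exp (s * ({u ∈ (E.X δ ω).loops | (u.range ∩ Metric.closedBall (0 : ℂ) R).Nonempty ∧ η ≤ Metric.diam u.range}.ncard : ℝ))) E.P ∧ ∫ ω, Real.exp (s * ({u ∈ (E.X δ ω).loops | (u.range ∩ Metric.closedBall (0 : ℂ) R).Nonempty ∧ η ≤ Metric.diam u.range}.ncard : ℝ)) ∂E.P ≤ C := by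
  intro E hE
  simp only [latticeEnsembles, Set.mem_insert_iff, Set.mem_singleton_iff] at hE
  rcases hE with rfl | rfl
  · exact expMoment_ncard_bigLoops_meeting_le_zEns
  · exact expMoment_ncard_bigLoops_meeting_le_tEns

end Summit.CriticalPhenomena.CardyFormulaZ2.Cruxes.NestingRigidity.PositiveConeWeightDoubling

end
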